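import Summits.BirchSwinnertonDyer.BirchSwinnertonDyer.Theorems.KimAtThreeFineKatoPerFactorDefinedTwist
import Summits.BirchSwinnertonDyer.BirchSwinnertonDyer.Theorems.KimAtThreeDeepLowerExpStarOmegaPlace
import Literature.NumberTheory.EllipticCurves.BSDConductorProofs
import HarnessLib

/-!
# Crux `KatoKuriharaPortThreeShared` (stmt-BirchSwinnertonDyer-19560): the factors `w ∣ v₀` of the level field
# `ℚ(ζ_m)` lie over `3` — the key for the `ℚ_3`-algebra / `|3|_w < 1` structures of the completions `L_w`
# (`LocalField.adicCompletionPadicAlgebra`, `valuation_adicCompletion_natCast_lt_one`) used by the LEAD's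
# per-factor packages with DEFINED `exp*_{L_w}` (`KimAtThreeFineKatoPerFactorParts`)
# (cell `bsd-addord`, seat kim3 gen 14; route W2 `KimAtThreeKolyvagin`; `--supports 19560`, helper)

TOOL lemma only; nothing about a curve; closes nothing; nothing booked.
-/

noncomputable section

-- the cell's Theorems namespace `Summit.BirchSwinnertonDyer.BirchSwinnertonDyer.…` repeats the summit name by design (D-0017)
set_option linter.dupNamespace false

open scoped NumberField
open IsDedekindDomain NumberField Literature.NumberTheory.EllipticCurves

namespace Summit.BirchSwinnertonDyer.BirchSwinnertonDyer.Theorems.KimAtThreeFineKatoPerFactorPlaces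

/-- **`3 ∈ w`** for a place `w` of `ℚ(ζ_m)` above the base place `v₀ = primesEquiv.symm 3` (`w.under 𝓞_ℚ = v₀`,
so `algebraMap 𝓞_ℚ 𝓞_L 3 ∈ w`): keys the `ℚ_3`-algebra / `|3|_w < 1` structures of `L_w`. [folklore] -/
theorem three_mem_asIdeal_extension (m : ℕ)
    (w : ((Rat.HeightOneSpectrum.primesEquiv (R := 𝓞 ℚ)).symm ⟨3, Fact.out⟩).Extension
      (𝓞 (CyclotomicField m ℚ))) :
    ((3 : ℕ) : 𝓞 (CyclotomicField m ℚ)) ∈ w.1.asIdeal := by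
  have h0 : ((3 : ℕ) : 𝓞 ℚ) ∈ ((Rat.HeightOneSpectrum.primesEquiv (R := 𝓞 ℚ)).symm ⟨3, Fact.out⟩).asIdeal :=
    (natCast_mem_asIdeal_iff_eq_primesEquiv_symm _ Nat.prime_three).mpr rfl
  have h1 := w.2
  rw [HeightOneSpectrum.ext_iff] at h1
  rw [← h1] at h0
  change ((3 : ℕ) : 𝓞 ℚ) ∈ Ideal.comap (algebraMap (𝓞 ℚ) (𝓞 (CyclotomicField m ℚ))) w.1.asIdeal at h0
  rw [Ideal.mem_comap, map_natCast] at h0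
  exact h0


end Summit.BirchSwinnertonDyer.BirchSwinnertonDyer.Theorems.KimAtThreeFineKatoPerFactorPlaces

end
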